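import Summits.Ventures.Crystal3D.Theorems.StickyWulffConstantTextureLiminfTexShadowRowSplitDefs
import HarnessLib

/-!
# TexShadow v6.12 §2c (v3, DECISION (xxxvii⁗)) — the generic wall part as ZIG-COVERED ∪ ROW-COVERED (c-layer strips) ∪
# ON-REACH ∪ DEFICIENT, with the ROW FLUX PER STRIP (lane T, crux `TextureLiminf`, stmt-Ventures-19483; cf-p1 §86(109) CZ)

HONEST FRAMING. Venture `Summits/Ventures/Crystal3D` (cell `crystal3d-full`), helper `--supports` the crux
`TextureLiminf` (stmt-Ventures-19483) of `route-Ventures-StickyWulffConstant`, registered line `TexShadow`.  Rung credit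
only; F-C1 not moved.  DEFINITIONS plus proved glue; NOT the wall law; NOT lane G's row family.

WHY v3 (19480-p2 g8's objection, upheld): in-layer ROWS are certified walker lines only on the `++` c-LAYERS of the presented
word (`σ k = 1 ∧ σ (k−1) = 1`: those sites are full in the plate frame `L`; `−−` c-layers are full in the mirror frame and are
not paid in the same cell; h-layers never — `not_exactOnly_hcpInPlaneStar`).  So the row flux is PER STRIP,
`rowFlux τ L σ z i := [IsCLayer σ i]·layerFlux τ L z` (layer `i`'s rows attributed to `laySlab i`, as in the slab-by-slab proof of
`layer_lines_ge_flux`), v2's strip-constant row corner (`…RowSplitDefs`: `RowSteep`, `cornerA/B`, `BilayerWallRowCovered/OnReachRow/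
OnReachZig`) is SUPERSEDED by the present file, and the orientation/word-deficient part RETURNS (h-rich plates in row-steep
orientations with weak zigzags: R45's hcp|hcp cells).  `RowSteep` and the v2 lemmas remain valid tree facts.

THE CORNER (deterministic, per plate walked toward `z`): ZIGZAGS if `ZigGood L σ z := DeltaSteep L z ∧ ∀ i, √2/2 ≤ bilayerRise L σ z i`
(then every strip's zig flux is `≥ 1 ≥` every admissible charge), else ROWS (then `RowSteep L z` by ZIGZAG OR ROWS, so the rows are
launchable, and the `++` strips carry row flux `≥ 1`, the others `0`).  `cornerFlux`, `zigW`/`rowW` (weights `1/0`),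
`RowMixDominated τ L₁ σ₁ L₂ σ₂ c := ∀ i j, c i j ≤ ½(cornerFlux₁ i + cornerFlux₂ j)`.

THE FOUR PARTS (same quantifier prefix as `BilayerWallGeneric`; `OffR` = lane G's «the chosen family pair is off-reach», a PARAMETER
pinned by the skeleton; for a `ZigGood` plate its clause is `BarlowOffReach`'s famSlot clause, for a row plate the same three reach
clauses with `chainFrames z L (bestLayerDir L z)` — 19480-p2 g8 18:39:36Z (4)):
* `BilayerWallWalkerCovered` — unchanged (`…CoverableSplitDefs`, CLOSED mod E1/StarPairFar by p654251);
* `BilayerWallRowCov OffR C R₀` — `RowMixDominated (√2/2) c ∧ OffR ⇒ BilayerWallAt` (by-name target of G's row F4 + the per-strip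
  row count `…LayerCountStrip` / `…CellFluxRowMix`, next files);
* `BilayerWallOnReachAll OffR C R₀` — `(ΔSteep₁ ∧ ΔSteep₂ ∧ FluxDominated c ∧ ¬BarlowOffReach) ∨ (RowMixDominated c ∧ ¬OffR) ⇒ …`
  (coincidence classes; one 19481-type owner, ROUTE §87);
* `BilayerWallDeficit C R₀` — `¬(ΔSteep₁ ∧ ΔSteep₂ ∧ FluxDominated c) ∧ ¬RowMixDominated c ⇒ …` (the restored deficient class);
* glue **`bilayerWallGeneric_of_four`** (proved) and **`rowMixDominated_of_le_one`**: every table `c ≤ 1` is row-mix-dominated as soon as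
  each ROW plate is `++`-pure (`∀ i, IsCLayer σ i`, e.g. fcc presented upward) — so `BilayerWallDeficit` only contains pairs with a
  row plate carrying a non-`++` strip (h-layers or `−−` layers of the given presentation).
WHAT THIS IS NOT: not the row F4, not `OffR`'s definition (lane G); not the counting inequality (next files); F-C1 not moved.
-/

noncomputable section

open scoped BigOperators InnerProductSpace ENNReal
open MeasureTheory Filter

namespace Summit.Ventures.Crystal3D.Cruxes.TextureLiminf.TexShadow

open Summit.Ventures.Crystal3D Summit.Ventures.Crystal3D.Theorems
open Literature.MathematicalPhysics.StatisticalMechanics (IsHaggSeq)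

/-! ## c-layer strips and the per-strip row flux -/

/-- Layer `k` of the PRESENTED word is a `++` c-LAYER: `σ k = 1 ∧ σ (k−1) = 1` (its sites are full in the plate frame, so its
in-layer rows are certified walker lines; lane G's convention of record). -/
def IsCLayer (σ : ℤ → ℤ) (k : ℤ) : Prop := σ k = 1 ∧ σ (k - 1) = 1

open scoped Classical in
/-- **Per-strip ROW FLUX**: `layerFlux τ L z` on the `++` c-layer strips, `0` elsewhere (layer `i`'s rows attributed to `laySlab i`). -/
def rowFlux (τ : ℝ) (L : E3 ≃ₗᵢ[ℝ] E3) (σ : ℤ → ℤ) (z : E3) (i : ℤ) : ℝ :=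
  if IsCLayer σ i then layerFlux τ L z else 0

/-! ## The corner -/

/-- The plate `(L, σ)` walked toward `z` is ZIG-GOOD: Δ-steep and EVERY zigzag step rises `≥ √2/2` (so every strip's zig flux is
`≥ 1`). -/
def ZigGood (L : E3 ≃ₗᵢ[ℝ] E3) (σ : ℤ → ℤ) (z : E3) : Prop :=
  DeltaSteep L z ∧ ∀ i : ℤ, Real.sqrt 2 / 2 ≤ bilayerRise L σ z i

open scoped Classical in
/-- **The corner's per-strip flux**: zigzag flux if zig-good, else the per-strip row flux. -/
def cornerFlux (τ : ℝ) (L : E3 ≃ₗᵢ[ℝ] E3) (σ : ℤ → ℤ) (z : E3) (i : ℤ) : ℝ :=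
  if ZigGood L σ z then plateFlux τ L σ z i else rowFlux τ L σ z i

open scoped Classical in
/-- zig weight of the corner (`1` if zig-good, else `0`). -/
def zigW (L : E3 ≃ₗᵢ[ℝ] E3) (σ : ℤ → ℤ) (z : E3) : ℝ := if ZigGood L σ z then 1 else 0

open scoped Classical in
/-- row weight of the corner (`0` if zig-good, else `1`). -/
def rowW (L : E3 ≃ₗᵢ[ℝ] E3) (σ : ℤ → ℤ) (z : E3) : ℝ := if ZigGood L σ z then 0 else 1

/-- **ROW-MIX DOMINATION (per strip)** of a table by the two plates' corner fluxes at steepness `τ`. -/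
def RowMixDominated (τ : ℝ) (L₁ : E3 ≃ₗᵢ[ℝ] E3) (σ₁ : ℤ → ℤ) (L₂ : E3 ≃ₗᵢ[ℝ] E3) (σ₂ : ℤ → ℤ) (c : ℤ → ℤ → ℝ) : Prop :=
  ∀ i j : ℤ, c i j ≤ (cornerFlux τ L₁ σ₁ e₃ i + cornerFlux τ L₂ σ₂ (-e₃) j) / 2

/-! ## The four parts (v6.12 of record) -/

/-- **ROW-COVERED PART** at `(C, R₀)` for the pair off-reach predicate `OffR` (lane G's, a parameter): generic pairs, tables
row-mix-dominated at `√2/2`, chosen family pair off-reach. -/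
def BilayerWallRowCov (OffR : (E3 ≃ₗᵢ[ℝ] E3) → E3 → (ℤ → ℤ) → (E3 ≃ₗᵢ[ℝ] E3) → E3 → (ℤ → ℤ) → Prop) (C R₀ : ℝ) : Prop :=
  ∀ (σ₁ σ₂ : ℤ → ℤ), IsHaggSeq σ₁ → IsHaggSeq σ₂ →
    ∀ (L₁ L₂ : E3 ≃ₗᵢ[ℝ] E3) (s₁ s₂ : E3) (A₁ A₂ : ℤ → (E3 ≃ₗᵢ[ℝ] E3)) (u₁ u₂ : ℤ → E3),
    BilayerFramesAt L₁ s₁ σ₁ A₁ u₁ → BilayerFramesAt L₂ s₂ σ₂ A₂ u₂ →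
    (∀ i j : ℤ, ¬ InResidualClass (A₁ i) (A₂ j) (u₁ i) (u₂ j)) →
    ∀ (c : ℤ → ℤ → ℝ) (m : ℤ → ℤ → E3), BilayerChargeAdmissible A₁ A₂ c m →
      RowMixDominated (Real.sqrt 2 / 2) L₁ σ₁ L₂ σ₂ c → OffR L₁ s₁ σ₁ L₂ s₂ σ₂ →
      BilayerWallAt C R₀ σ₁ σ₂ L₁ L₂ s₁ s₂ c

/-- **ON-REACH PART** at `(C, R₀)`: a payable corner whose reach is obstructed — the zigzag pair (both Δ-steep, table
flux-dominated, NOT Barlow off-reach) or the row-mix corner (table dominated, NOT `OffR`).  Coincidence classes. -/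
def BilayerWallOnReachAll (OffR : (E3 ≃ₗᵢ[ℝ] E3) → E3 → (ℤ → ℤ) → (E3 ≃ₗᵢ[ℝ] E3) → E3 → (ℤ → ℤ) → Prop) (C R₀ : ℝ) :
    Prop :=
  ∀ (σ₁ σ₂ : ℤ → ℤ), IsHaggSeq σ₁ → IsHaggSeq σ₂ →
    ∀ (L₁ L₂ : E3 ≃ₗᵢ[ℝ] E3) (s₁ s₂ : E3) (A₁ A₂ : ℤ → (E3 ≃ₗᵢ[ℝ] E3)) (u₁ u₂ : ℤ → E3),
    BilayerFramesAt L₁ s₁ σ₁ A₁ u₁ → BilayerFramesAt L₂ s₂ σ₂ A₂ u₂ →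
    (∀ i j : ℤ, ¬ InResidualClass (A₁ i) (A₂ j) (u₁ i) (u₂ j)) →
    ∀ (c : ℤ → ℤ → ℝ) (m : ℤ → ℤ → E3), BilayerChargeAdmissible A₁ A₂ c m →
      ((DeltaSteep L₁ e₃ ∧ DeltaSteep L₂ (-e₃) ∧ FluxDominated (Real.sqrt 2 / 2) L₁ σ₁ L₂ σ₂ c ∧
          ¬ BarlowOffReach L₁ s₁ σ₁ L₂ s₂ σ₂) ∨
        (RowMixDominated (Real.sqrt 2 / 2) L₁ σ₁ L₂ σ₂ c ∧ ¬ OffR L₁ s₁ σ₁ L₂ s₂ σ₂)) →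
      BilayerWallAt C R₀ σ₁ σ₂ L₁ L₂ s₁ s₂ c

/-- **DEFICIENT PART** at `(C, R₀)` (restored, v2): tables that NEITHER the zigzag pair (not both Δ-steep, or not flux-dominated)
NOR the row-mix corner dominates — by `rowMixDominated_of_le_one` only pairs with a ROW plate carrying a non-`++` strip
(h-rich words in row-steep orientations with weak zigzags: R45's hcp|hcp class).  Road: (L3) certificate or an accepted charge `< 1`. -/
def BilayerWallDeficit (C R₀ : ℝ) : Prop :=
  ∀ (σ₁ σ₂ : ℤ → ℤ), IsHaggSeq σ₁ → IsHaggSeq σ₂ →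
    ∀ (L₁ L₂ : E3 ≃ₗᵢ[ℝ] E3) (s₁ s₂ : E3) (A₁ A₂ : ℤ → (E3 ≃ₗᵢ[ℝ] E3)) (u₁ u₂ : ℤ → E3),
    BilayerFramesAt L₁ s₁ σ₁ A₁ u₁ → BilayerFramesAt L₂ s₂ σ₂ A₂ u₂ →
    (∀ i j : ℤ, ¬ InResidualClass (A₁ i) (A₂ j) (u₁ i) (u₂ j)) →
    ∀ (c : ℤ → ℤ → ℝ) (m : ℤ → ℤ → E3), BilayerChargeAdmissible A₁ A₂ c m →
      ¬ (DeltaSteep L₁ e₃ ∧ DeltaSteep L₂ (-e₃) ∧ FluxDominated (Real.sqrt 2 / 2) L₁ σ₁ L₂ σ₂ c) →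
      ¬ RowMixDominated (Real.sqrt 2 / 2) L₁ σ₁ L₂ σ₂ c →
      BilayerWallAt C R₀ σ₁ σ₂ L₁ L₂ s₁ s₂ c

/-- The row-covered part holds FROM plate thickness `R` on. -/
def BilayerWallRowCovFrom (OffR : (E3 ≃ₗᵢ[ℝ] E3) → E3 → (ℤ → ℤ) → (E3 ≃ₗᵢ[ℝ] E3) → E3 → (ℤ → ℤ) → Prop) (R : ℝ) : Prop :=
  ∀ R₀ : ℝ, R ≤ R₀ → ∃ C : ℝ, BilayerWallRowCov OffR C R₀

/-- The on-reach part holds FROM plate thickness `R` on. -/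
def BilayerWallOnReachAllFrom (OffR : (E3 ≃ₗᵢ[ℝ] E3) → E3 → (ℤ → ℤ) → (E3 ≃ₗᵢ[ℝ] E3) → E3 → (ℤ → ℤ) → Prop) (R : ℝ) :
    Prop :=
  ∀ R₀ : ℝ, R ≤ R₀ → ∃ C : ℝ, BilayerWallOnReachAll OffR C R₀

/-- The deficient part holds FROM plate thickness `R` on. -/
def BilayerWallDeficitFrom (R : ℝ) : Prop := ∀ R₀ : ℝ, R ≤ R₀ → ∃ C : ℝ, BilayerWallDeficit C R₀

/-! ## Glue and the content of the deficient part -/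

/-- **Glue (real proof, v6.12): zig-covered ∪ row-covered ∪ on-reach ∪ deficient ⇒ generic.** -/
theorem bilayerWallGeneric_of_four
    {OffR : (E3 ≃ₗᵢ[ℝ] E3) → E3 → (ℤ → ℤ) → (E3 ≃ₗᵢ[ℝ] E3) → E3 → (ℤ → ℤ) → Prop}
    {R_W R_R R_O R_D : ℝ} (hW1 : 1 ≤ R_W) (hW : BilayerWallWalkerCoveredFrom R_W)
    (hR : BilayerWallRowCovFrom OffR R_R) (hO : BilayerWallOnReachAllFrom OffR R_O) (hD : BilayerWallDeficitFrom R_D) :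
    BilayerWallGenericFrom (max (max R_W R_R) (max R_O R_D)) := by
  classical
  intro R₀ hR₀
  have hR₀W : R_W ≤ R₀ := le_trans (le_trans (le_max_left _ _) (le_max_left _ _)) hR₀
  have hR₀R : R_R ≤ R₀ := le_trans (le_trans (le_max_right _ _) (le_max_left _ _)) hR₀
  have hR₀O : R_O ≤ R₀ := le_trans (le_trans (le_max_left _ _) (le_max_right _ _)) hR₀
  have hR₀D : R_D ≤ R₀ := le_trans (le_trans (le_max_right _ _) (le_max_right _ _)) hR₀
  have hR₀0 : 0 ≤ R₀ := by linarith
  obtain ⟨C₁, hC₁⟩ := hW R₀ hR₀W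
  obtain ⟨C₂, hC₂⟩ := hR R₀ hR₀R
  obtain ⟨C₃, hC₃⟩ := hO R₀ hR₀O
  obtain ⟨C₄, hC₄⟩ := hD R₀ hR₀D
  refine ⟨max (max C₁ C₂) (max C₃ C₄), ?_⟩
  intro σ₁ σ₂ hσ₁ hσ₂ L₁ L₂ s₁ s₂ A₁ A₂ u₁ u₂ hu₁ hu₂ hgen c m hadm
  by_cases hZ : DeltaSteep L₁ e₃ ∧ DeltaSteep L₂ (-e₃) ∧ FluxDominated (Real.sqrt 2 / 2) L₁ σ₁ L₂ σ₂ c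
  · by_cases hoff : BarlowOffReach L₁ s₁ σ₁ L₂ s₂ σ₂
    · exact bilayerWallAt_mono hR₀0 (le_trans (le_max_left _ _) (le_max_left _ _))
        (hC₁ σ₁ σ₂ hσ₁ hσ₂ L₁ L₂ s₁ s₂ A₁ A₂ u₁ u₂ hu₁ hu₂ hgen ⟨hZ.1, hZ.2.1, hoff⟩ c m hadm hZ.2.2)
    · exact bilayerWallAt_mono hR₀0 (le_trans (le_max_left _ _) (le_max_right _ _))
        (hC₃ σ₁ σ₂ hσ₁ hσ₂ L₁ L₂ s₁ s₂ A₁ A₂ u₁ u₂ hu₁ hu₂ hgen c m hadm (Or.inl ⟨hZ.1, hZ.2.1, hZ.2.2, hoff⟩))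
  · by_cases hRow : RowMixDominated (Real.sqrt 2 / 2) L₁ σ₁ L₂ σ₂ c
    · by_cases hoff : OffR L₁ s₁ σ₁ L₂ s₂ σ₂
      · exact bilayerWallAt_mono hR₀0 (le_trans (le_max_right _ _) (le_max_left _ _))
          (hC₂ σ₁ σ₂ hσ₁ hσ₂ L₁ L₂ s₁ s₂ A₁ A₂ u₁ u₂ hu₁ hu₂ hgen c m hadm hRow hoff)
      · exact bilayerWallAt_mono hR₀0 (le_trans (le_max_left _ _) (le_max_right _ _))
          (hC₃ σ₁ σ₂ hσ₁ hσ₂ L₁ L₂ s₁ s₂ A₁ A₂ u₁ u₂ hu₁ hu₂ hgen c m hadm (Or.inr ⟨hRow, hoff⟩))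
    · exact bilayerWallAt_mono hR₀0 (le_trans (le_max_right _ _) (le_max_right _ _))
        (hC₄ σ₁ σ₂ hσ₁ hσ₂ L₁ L₂ s₁ s₂ A₁ A₂ u₁ u₂ hu₁ hu₂ hgen c m hadm hZ hRow)

/-- A plate that is not zig-good is row-steep (ZIGZAG OR ROWS): the row corner is always LAUNCHABLE. -/
theorem rowSteep_of_not_zigGood {L : E3 ≃ₗᵢ[ℝ] E3} {σ : ℤ → ℤ} {z : E3} (hz : ‖z‖ = 1) (h : ¬ ZigGood L σ z) :
    RowSteep L z := by
  rcases layerSteep_or_deltaSteep L σ hz with h' | h'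
  · exact h'
  · exact absurd h' h

/-- Row flux bounds: `0 ≤ rowFlux ≤ layerFlux`. -/
theorem rowFlux_nonneg_le (τ : ℝ) (L : E3 ≃ₗᵢ[ℝ] E3) (σ : ℤ → ℤ) (z : E3) (i : ℤ) :
    0 ≤ rowFlux τ L σ z i ∧ rowFlux τ L σ z i ≤ layerFlux τ L z := by
  unfold rowFlux
  split_ifs
  · exact ⟨layerFlux_nonneg τ L z, le_rfl⟩
  · exact ⟨le_rfl, layerFlux_nonneg τ L z⟩

/-- The corner flux as a weighted sum: `cornerFlux = zigW·plateFlux + rowW·rowFlux`, weights in `{0,1}`. -/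
theorem cornerFlux_eq_weights (τ : ℝ) (L : E3 ≃ₗᵢ[ℝ] E3) (σ : ℤ → ℤ) (z : E3) (i : ℤ) :
    cornerFlux τ L σ z i = zigW L σ z * plateFlux τ L σ z i + rowW L σ z * rowFlux τ L σ z i := by
  unfold cornerFlux zigW rowW
  split_ifs <;> simp

/-- Weights are `0` or `1` and sum to `1`. -/
theorem zigW_rowW (L : E3 ≃ₗᵢ[ℝ] E3) (σ : ℤ → ℤ) (z : E3) :
    0 ≤ zigW L σ z ∧ zigW L σ z ≤ 1 ∧ 0 ≤ rowW L σ z ∧ rowW L σ z ≤ 1 ∧ zigW L σ z + rowW L σ z = 1 := by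
  unfold zigW rowW
  split_ifs <;> norm_num

/-- **At the corner every table `c ≤ 1` is row-mix-dominated as soon as each ROW plate is `++`-pure** (zig-good plates: every zig
flux `≥ 1`; row plates: row-steep by `rowSteep_of_not_zigGood`, so every `++` strip carries `layerFlux ≥ 1`). -/
theorem rowMixDominated_of_le_one (L₁ L₂ : E3 ≃ₗᵢ[ℝ] E3) (σ₁ σ₂ : ℤ → ℤ) (c : ℤ → ℤ → ℝ) (hc1 : ∀ i j, c i j ≤ 1)
    (h₁ : ZigGood L₁ σ₁ e₃ ∨ ∀ i, IsCLayer σ₁ i) (h₂ : ZigGood L₂ σ₂ (-e₃) ∨ ∀ i, IsCLayer σ₂ i) :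
    RowMixDominated (Real.sqrt 2 / 2) L₁ σ₁ L₂ σ₂ c := by
  classical
  obtain ⟨he, hne⟩ := norm_e₃_and_neg
  have hs2 : 0 < Real.sqrt 2 := Real.sqrt_pos.2 (by norm_num)
  have h2 : Real.sqrt 2 ^ 2 = 2 := Real.sq_sqrt (by norm_num)
  have hone : Real.sqrt 2 * (Real.sqrt 2 / 2) = 1 := by nlinarith [h2]
  have plate : ∀ (L : E3 ≃ₗᵢ[ℝ] E3) (σ : ℤ → ℤ) (z : E3), ‖z‖ = 1 → (ZigGood L σ z ∨ ∀ i, IsCLayer σ i) →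
      ∀ i, 1 ≤ cornerFlux (Real.sqrt 2 / 2) L σ z i := by
    intro L σ z hz h i
    unfold cornerFlux
    by_cases hZ : ZigGood L σ z
    · rw [if_pos hZ]
      obtain ⟨-, hall⟩ := hZ
      have hl : PlateLaunchable (Real.sqrt 2 / 2) L σ z := ⟨0, hall 0⟩
      rw [plateFlux, if_pos hl, ← hone]
      exact mul_le_mul_of_nonneg_left (hall i) hs2.le
    · rw [if_neg hZ]
      have hC : IsCLayer σ i := (h.resolve_left hZ) i
      have hrow : RowSteep L z := rowSteep_of_not_zigGood hz hZ
      unfold rowFlux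
      rw [if_pos hC]
      unfold layerFlux
      rw [if_pos (show Real.sqrt 2 / 2 ≤ layerRise L z from hrow), ← hone]
      exact mul_le_mul_of_nonneg_left hrow hs2.le
  intro i j
  have := plate L₁ σ₁ e₃ he h₁ i; have := plate L₂ σ₂ (-e₃) hne h₂ j; have := hc1 i j
  linarith

end Summit.Ventures.Crystal3D.Cruxes.TextureLiminf.TexShadow

end
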